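import Summits.BirchSwinnertonDyer.BirchSwinnertonDyer.Theorems.PrintCFramBottomClassIndexLawFiveLeHerbrandOddClassGroupFinal
import Summits.BirchSwinnertonDyer.BirchSwinnertonDyer.Theorems.PrintCFramBottomClassIndexLawFiveLeHerbrandOddUnramifiedEquivariant
import HarnessLib

/-!
# Route `PrintCFram`, crux C2 `BottomClassIndexLawFiveLe` (stmt-BirchSwinnertonDyer-20372), line
# `eisenstein-resource-bdp-line` (LEAD g9, Road C «conjugation swap», stub O): HOM FORM OF THE ODD CLASS-GROUP VANISHING AND
# THE `Γ_L`-LEVEL ODD VANISHING (Lemma A ∘ Lemma B ∘ Mazur–Wiles)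
# (cell `bsd-print-cfram`, seat `bsd-line-cfram-p1-w6` g0; helper `--supports` 20372; 0 facts, 0 defs)

HONEST FRAMING. Nothing about BSD is proved here; no summit statement is proved by this seat. Stub O of Road C says: an
`r`-isotypic continuous additive character of `N = Γ_L ≤ Γ_ℚ` with values in `𝔽_p` that kills every inertia group vanishes
(`r` odd, `‖B_{1,(ω r)⁻¹}‖_p = 1`, Mazur–Wiles). This file closes the mathematics of O in `Γ_L`-currency; only the dictionary
`N ≤ Γ_ℚ` ↔ `Γ_L` (D-gal, w4 g5) and LEAD g9's registered v12 wording remain for the wrapper.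

* §1 HOM ⟷ FUNCTIONAL (pure algebra): an additive `f : M → 𝔽_p` with `f(ρ(g) x) = θ̄(g) f(x)` is the restriction to `1 ⊗ M` of the
  `𝔽_p`-linear functional `a ⊗ x ↦ a·f(x)` on `𝔽_p ⊗_ℤ M`, which is `θ̄`-equivariant; so the DUAL form F1ᵈ
  (`linearMap_classGroup_modP_eq_zero_final`) kills every `θ̄`-equivariant hom `Cl(L) → 𝔽_p`
  (`monoidHom_eq_one_of_forall_linearMap_eq_zero`, `classGroupHom_eq_one_final[_of_units]`).
* §2 `Γ_L`-LEVEL ODD VANISHING (`absGaloisHom_eq_one_final`): `κ : Γ_L →* 𝔽_p` (multiplicative copy) with open kernel, killing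
  `I_𝔓` for every prime `𝔓` of `\bar ℤ_L`, and `κ(θ_γ σ) = κ(σ)^{r(γ)}` under the outer action of `Γ_ℚ`, is trivial — by Lemma A
  (`exists_factor_classGroup_of_unramified_of_odd`: `κ` factors through `Cl(L)`, `p` odd handles the real places), Lemma B
  (`classGroupHom_mulEquiv_eq_pow_val`: the factor `g` is `r̄`-equivariant) and §1.

THEOREMS ONLY; no definition, no named fact, no `sorry`; imports no `Theses` module. Mazur–Wiles Thm. 2 is a HYPOTHESIS (`hMW`).
References: [MazurWiles1984] Thm. 2 (p. 216) via [Solomon1990] p. 468; [Washington1997] §6.3; [NeukirchANT1999] Ch. VI §7 (7.1).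
-/

set_option autoImplicit false
-- `…BirchSwinnertonDyer.BirchSwinnertonDyer.Theorems…` is the problem's mandated namespace (D-0017).
set_option linter.dupNamespace false

noncomputable section

open scoped TensorProduct
open NumberField Field Module Module.End IsDedekindDomain
open Literature.RepresentationTheory.FiniteGroups Literature.NumberTheory.NumberFields
open Literature.NumberTheory.GaloisRepresentations Literature.NumberTheory.EllipticCurves
open Literature.NumberTheory.LFunctions

namespace Summit.BirchSwinnertonDyer.BirchSwinnertonDyer.Theorems.PrintCFram.HerbrandOddClassGroup

/-! ## §1 Hom ⟷ functional -/

section Algebra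

variable {p : ℕ} [Fact p.Prime] {G : Type*} [Group G] {M : Type*} [AddCommGroup M]

/-- **Hom form from the dual form.** If every `θ̄`-equivariant `𝔽_p`-linear functional on `𝔽_p ⊗_ℤ M` vanishes, then every additive
`f : M → 𝔽_p` with `f(ρ(g) x) = θ̄(g)·f(x)` vanishes: `f` is `x ↦ F(1 ⊗ x)` for the `𝔽_p`-linear functional `F(a ⊗ x) = a·f(x)`,
which is `θ̄`-equivariant. [cite: Washington1997, §6.3 (χ-components of 𝔽_p[G]-modules)] -/
theorem addMonoidHom_eq_zero_of_forall_linearMap_eq_zero (ρ : Representation ℤ G M) (θ : G →* (ZMod p)ˣ)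
    (hvan : ∀ F : ZMod p ⊗[ℤ] M →ₗ[ZMod p] ZMod p,
      (∀ (g : G) (ξ : ZMod p ⊗[ℤ] M), F (baseChangeRep (ZMod p) ρ g ξ) = ((θ g : (ZMod p)ˣ) : ZMod p) • F ξ) → F = 0)
    (f : M →+ ZMod p) (hf : ∀ (g : G) (x : M), f (ρ g x) = ((θ g : (ZMod p)ˣ) : ZMod p) * f x) :
    f = 0 := by
  -- the functional `F(a ⊗ x) = a · f x`
  let F : ZMod p ⊗[ℤ] M →ₗ[ZMod p] ZMod p :=
    (Algebra.TensorProduct.lmul'' (S := ZMod p) ℤ).toLinearMap ∘ₗ (f.toIntLinearMap.baseChange (ZMod p))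
  have hFt : ∀ (a : ZMod p) (x : M), F (a ⊗ₜ[ℤ] x) = a * f x := fun a x => rfl
  have hF0 : F = 0 := hvan F fun g ξ => by
    obtain ⟨x, rfl⟩ := exists_one_tmul_eq ξ
    rw [baseChangeRep_apply_tmul, hFt, hFt, hf, one_mul, one_mul, smul_eq_mul]
  ext x
  rw [AddMonoidHom.zero_apply, ← one_mul (f x), ← hFt, hF0, LinearMap.zero_apply]

/-- Multiplicative wording: a homomorphism `φ : Multiplicative M →* 𝔽_p` … — specialised at once to the case we need, the CLASS GROUP:
if every `θ̄`-equivariant `𝔽_p`-linear functional on `𝔽_p ⊗_ℤ Cl(L)` vanishes, then every `g : Cl(L) →* 𝔽_p` (multiplicative copy)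
with `g(σ · c) = g(c)^{θ̄(σ)}` is trivial. [cite: Washington1997, §6.3 (χ-components of 𝔽_p[G]-modules)] -/
theorem classGroupHom_eq_one_of_forall_linearMap_eq_zero {F' L : Type*} [Field F'] [Field L] [NumberField L] [Algebra F' L]
    (θ : (L ≃ₐ[F'] L) →* (ZMod p)ˣ)
    (hvan : ∀ F : ZMod p ⊗[ℤ] Additive (ClassGroup (𝓞 L)) →ₗ[ZMod p] ZMod p,
      (∀ (σ : L ≃ₐ[F'] L) (ξ : ZMod p ⊗[ℤ] Additive (ClassGroup (𝓞 L))),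
        F (baseChangeRep (ZMod p) (classGroupRep F' L) σ ξ) = ((θ σ : (ZMod p)ˣ) : ZMod p) • F ξ) → F = 0)
    (g : ClassGroup (𝓞 L) →* Multiplicative (ZMod p))
    (hg : ∀ (σ : L ≃ₐ[F'] L) (c : ClassGroup (𝓞 L)),
      g (ClassGroup.mulEquiv (AmbiguousClass.intAut σ) c) = g c ^ ((θ σ : (ZMod p)ˣ) : ZMod p).val) :
    g = 1 := by
  have h := addMonoidHom_eq_zero_of_forall_linearMap_eq_zero (classGroupRep F' L) θ hvan
    (MonoidHom.toAdditiveLeft g) fun σ x => by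
      have hx : classGroupRep F' L σ x = Additive.ofMul (ClassGroup.mulEquiv (AmbiguousClass.intAut σ) (Additive.toMul x)) :=
        classGroupRep_apply (F := F') (L := L) σ (Additive.toMul x)
      simp only [MonoidHom.coe_toAdditiveLeft, Function.comp_apply]
      rw [hx, toMul_ofMul, hg, toAdd_pow, nsmul_eq_mul, ZMod.natCast_zmod_val]
  ext c
  have hc := DFunLike.congr_fun h (Additive.ofMul c)
  rw [MonoidHom.coe_toAdditiveLeft, Function.comp_apply, Function.comp_apply, toMul_ofMul,
    AddMonoidHom.zero_apply] at hc
  rw [MonoidHom.one_apply, ← ofAdd_toAdd (g c), hc, ofAdd_zero]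

end Algebra

/-! ## §1' Hom form, final (Mazur–Wiles data in `Γ_ℚ`-currency) -/

variable {p : ℕ} [Fact p.Prime] {L : Type} [Field L] [NumberField L] [IsAbelianGalois ℚ L]

/-- **HOM form, final.** `p` odd, `L/ℚ` abelian with `p ∤ [L:ℚ]`, `χ` a primitive odd `ℚ_p`-valued Dirichlet character with
`‖B_{1,χ⁻¹}‖_p = 1`, `φ : Γ_ℚ → ℤ_pˣ` trivial on `Γ_L` with `φ = χ ∘ χ_f`; ASSUME Mazur–Wiles (Frobenius-avatar typing). Then every
`g : Cl(L) →* 𝔽_p` (multiplicative copy) with `g(τ̄ · c) = g(c)^{φ(τ) mod p}` for all `τ ∈ Γ_ℚ` is trivial.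
[cite: MazurWiles1984, Thm. 2 (p. 216) — via Solomon1990, §I p. 468; Washington1997, §6.3] -/
theorem classGroupHom_eq_one_final
    (hMW : MazurWiles1984.thm2_oddChiPart_classGroup_card_eq_pow_val_bernoulli) (hp2 : p ≠ 2)
    (hpL : ¬ p ∣ Module.finrank ℚ L)
    {f : ℕ} [NeZero f] {χ : DirichletCharacter ℚ_[p] f} (hprim : χ.IsPrimitive) (hodd : χ.Odd)
    (φ : absoluteGaloisGroup ℚ →* ℤ_[p]ˣ)
    (hφL : ∀ σ : absoluteGaloisGroup L, φ (absGaloisRestrict ℚ L σ) = 1)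
    (hφχ : ∀ τ : absoluteGaloisGroup ℚ,
      (((φ τ : ℤ_[p]ˣ) : ℤ_[p]) : ℚ_[p]) = χ ((modNCyclotomicCharacter ℚ f τ : (ZMod f)ˣ) : ZMod f))
    (hB : ‖KrizLi2019.bernoulliOnePrim χ⁻¹‖ = 1)
    (g : ClassGroup (𝓞 L) →* Multiplicative (ZMod p))
    (hg : ∀ (τ : absoluteGaloisGroup ℚ) (c : ClassGroup (𝓞 L)),
      g (ClassGroup.mulEquiv (AmbiguousClass.intAut (absGaloisQuot ℚ L τ)) c) =
        g c ^ (PadicInt.toZMod ((φ τ : ℤ_[p]ˣ) : ℤ_[p])).val) :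
    g = 1 := by
  obtain ⟨ψ, hψ⟩ := exists_factor_absGaloisQuot ℚ L φ hφL
  let θ : (L ≃ₐ[ℚ] L) →* (ZMod p)ˣ := (Units.map (PadicInt.toZMod (p := p)).toMonoidHom).comp ψ
  have hθ : ∀ σ : L ≃ₐ[ℚ] L, PadicInt.toZMod ((ψ σ : ℤ_[p]ˣ) : ℤ_[p]) = ((θ σ : (ZMod p)ˣ) : ZMod p) :=
    fun σ => rfl
  refine classGroupHom_eq_one_of_forall_linearMap_eq_zero θ
    (fun F hF => linearMap_classGroup_modP_eq_zero_final hMW hp2 hpL hprim hodd φ hφχ hB ψ hψ θ hθ F hF) g fun σ c => ?_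
  obtain ⟨τ, rfl⟩ := absGaloisQuot_surjective ℚ L σ
  rw [hg τ, ← hθ, hψ τ]

/-- The same with the eigen-exponent read through a character `r : Γ_ℚ → 𝔽_pˣ` with `φ mod p = r` (e.g. `φ = ω ∘ r`, the Teichmüller
lift): `g(τ̄ · c) = g(c)^{r(τ)}` for all `τ` forces `g = 1` — the output currency of `classGroupHom_mulEquiv_eq_pow_val`.
[cite: MazurWiles1984, Thm. 2 (p. 216) — via Solomon1990, §I p. 468; Washington1997, §6.3] -/
theorem classGroupHom_eq_one_final_of_units
    (hMW : MazurWiles1984.thm2_oddChiPart_classGroup_card_eq_pow_val_bernoulli) (hp2 : p ≠ 2)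
    (hpL : ¬ p ∣ Module.finrank ℚ L)
    {f : ℕ} [NeZero f] {χ : DirichletCharacter ℚ_[p] f} (hprim : χ.IsPrimitive) (hodd : χ.Odd)
    (φ : absoluteGaloisGroup ℚ →* ℤ_[p]ˣ)
    (hφL : ∀ σ : absoluteGaloisGroup L, φ (absGaloisRestrict ℚ L σ) = 1)
    (hφχ : ∀ τ : absoluteGaloisGroup ℚ,
      (((φ τ : ℤ_[p]ˣ) : ℤ_[p]) : ℚ_[p]) = χ ((modNCyclotomicCharacter ℚ f τ : (ZMod f)ˣ) : ZMod f))
    (hB : ‖KrizLi2019.bernoulliOnePrim χ⁻¹‖ = 1)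
    (r : absoluteGaloisGroup ℚ →* (ZMod p)ˣ)
    (hr : ∀ τ : absoluteGaloisGroup ℚ, PadicInt.toZMod ((φ τ : ℤ_[p]ˣ) : ℤ_[p]) = ((r τ : (ZMod p)ˣ) : ZMod p))
    (g : ClassGroup (𝓞 L) →* Multiplicative (ZMod p))
    (hg : ∀ (τ : absoluteGaloisGroup ℚ) (c : ClassGroup (𝓞 L)),
      g (ClassGroup.mulEquiv (AmbiguousClass.intAut (absGaloisQuot ℚ L τ)) c) = g c ^ ((r τ : (ZMod p)ˣ) : ZMod p).val) :
    g = 1 :=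
  classGroupHom_eq_one_final hMW hp2 hpL hprim hodd φ hφL hφχ hB g fun τ c => by rw [hg τ c, hr τ]

/-! ## §2 The `Γ_L`-level odd vanishing (stub O modulo the dictionary `N ≤ Γ_ℚ` ↔ `Γ_L`) -/

/-- `𝔽_p` (multiplicative copy) has odd order for `p` an odd prime. [cite: Washington1997, §6.3] -/
theorem odd_natCard_multiplicative_zmod (hp2 : p ≠ 2) : Odd (Nat.card (Multiplicative (ZMod p))) := by
  rw [Nat.card_eq_fintype_card, Fintype.card_multiplicative, ZMod.card]
  exact (Fact.out : p.Prime).odd_of_ne_two hp2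

/-- **`Γ_L`-LEVEL ODD VANISHING (stub O's mathematics).** `p` odd, `L/ℚ` abelian with `p ∤ [L:ℚ]`, `χ` primitive odd with
`‖B_{1,χ⁻¹}‖_p = 1`, `φ : Γ_ℚ → ℤ_pˣ` trivial on `Γ_L` with `φ = χ ∘ χ_f` and reduction `r = φ mod p : Γ_ℚ → 𝔽_pˣ`; ASSUME Mazur–Wiles.
Let `κ : Γ_L →* 𝔽_p` (multiplicative copy) have open kernel, kill the inertia group `I_𝔓 ≤ Γ_L` of every prime `𝔓` of `\bar ℤ_L`,
and satisfy the eigen-law `κ(θ_γ σ) = κ(σ)^{r(γ)}` under the outer action `θ_γ = absGaloisOuterConj ℚ L γ` of `Γ_ℚ`. Then `κ = 1`.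
(Lemma A: `κ` factors through `Cl(L)` — `p` odd makes `κ` kill complex conjugations; Lemma B: the factor is `r̄`-equivariant;
§1': Mazur–Wiles.) [cite: MazurWiles1984, Thm. 2 (p. 216) — via Solomon1990, §I p. 468; NeukirchANT1999, Ch. VI §7 Thm. (7.1)] -/
theorem absGaloisHom_eq_one_final
    (hMW : MazurWiles1984.thm2_oddChiPart_classGroup_card_eq_pow_val_bernoulli) (hp2 : p ≠ 2)
    (hpL : ¬ p ∣ Module.finrank ℚ L)
    {f : ℕ} [NeZero f] {χ : DirichletCharacter ℚ_[p] f} (hprim : χ.IsPrimitive) (hodd : χ.Odd)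
    (φ : absoluteGaloisGroup ℚ →* ℤ_[p]ˣ)
    (hφL : ∀ σ : absoluteGaloisGroup L, φ (absGaloisRestrict ℚ L σ) = 1)
    (hφχ : ∀ τ : absoluteGaloisGroup ℚ,
      (((φ τ : ℤ_[p]ˣ) : ℤ_[p]) : ℚ_[p]) = χ ((modNCyclotomicCharacter ℚ f τ : (ZMod f)ˣ) : ZMod f))
    (hB : ‖KrizLi2019.bernoulliOnePrim χ⁻¹‖ = 1)
    (r : absoluteGaloisGroup ℚ →* (ZMod p)ˣ)
    (hr : ∀ τ : absoluteGaloisGroup ℚ, PadicInt.toZMod ((φ τ : ℤ_[p]ˣ) : ℤ_[p]) = ((r τ : (ZMod p)ˣ) : ZMod p))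
    (κ : absoluteGaloisGroup L →* Multiplicative (ZMod p)) (hκ : IsOpen (κ.ker : Set (absoluteGaloisGroup L)))
    (hunr : ∀ (v : HeightOneSpectrum (𝓞 L)) (𝔓 : Ideal (absIntegers (𝓞 L) L)), 𝔓 ∈ v.primesAbove →
      ∀ g ∈ 𝔓.inertia (absoluteGaloisGroup L), κ g = 1)
    (heq : ∀ (γ : absoluteGaloisGroup ℚ) (σ : absoluteGaloisGroup L),
      κ (absGaloisOuterConj ℚ L γ σ) = (κ σ) ^ ((r γ : (ZMod p)ˣ) : ZMod p).val) :
    κ = 1 := by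
  haveI : IsGalois ℚ L := IsAbelianGalois.toIsGalois
  obtain ⟨g, hg⟩ := exists_factor_classGroup_of_unramified_of_odd L (odd_natCard_multiplicative_zmod hp2) κ hκ hunr
  have hg1 : g = 1 := classGroupHom_eq_one_final_of_units hMW hp2 hpL hprim hodd φ hφL hφχ hB r hr g
    fun τ c => classGroupHom_mulEquiv_eq_pow_val hg r heq τ c
  ext τ
  rw [hg τ, hg1, MonoidHom.one_apply, MonoidHom.one_apply]

end Summit.BirchSwinnertonDyer.BirchSwinnertonDyer.Theorems.PrintCFram.HerbrandOddClassGroup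

end
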